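import Literature.MathematicalPhysics.QuantumLattice.FermiRG.FST2SecondOrderStrings
import Mathlib.Analysis.SpecialFunctions.SmoothTransition
import Mathlib.Analysis.Calculus.Deriv.Inv
import HarnessLib

/-!
# Feldman–Salmhofer–Trubowitz II: the cutoff function of the scale decomposition exists

Proof companion (no definitions, no named facts) of `FST2SecondOrderStrings.lean`: the data
`ScaleCutoff M` of [II §2.4, p.10 L56–59] — "let `a ∈ C^∞(ℝ₀⁺, [0,1])` be such that `a(x) = 0` for
`0 ≤ x ≤ M⁻⁴`, `a(x) = 1` for `x ≥ M⁻²`, and `a'(x) > 0` for all `x ∈ (M⁻⁴, M⁻²)`" — is NON-VACUOUS for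
every `M > 1` (in [II], `M ≥ max{4³, 1/r₀}`): rescale Mathlib's `Real.smoothTransition` to the interval
`[M⁻⁴, M⁻²]`. On the way we record the derivative of `Real.smoothTransition` and its strict positivity on
`(0, 1)`, which Mathlib does not state (private helpers).

* [II] J. Feldman, M. Salmhofer, E. Trubowitz, *Perturbation theory around non-nested Fermi surfaces II*,
  Comm. Pure Appl. Math. **51** (1998) 1133–1246, arXiv:cond-mat/9701073 (`FeldmanSalmhoferTrubowitz1998`);
  locators = chunk/line of the `lit read arxiv:cond-mat/9701073` render.
-/

noncomputable section

open Set Real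

namespace Literature.MathematicalPhysics.QuantumLattice.FermiRG

namespace ScaleCutoff

/-- The derivative of Mathlib's gluing function `expNegInvGlue x = e^{-1/x}` (`x > 0`), `0` (`x ≤ 0`):
`x⁻² e^{-1/x}` (the case `p = 1` of `expNegInvGlue.hasDerivAt_polynomial_eval_inv_mul`). [folklore] -/
private theorem hasDerivAt_expNegInvGlue (x : ℝ) :
    HasDerivAt expNegInvGlue (x⁻¹ ^ 2 * expNegInvGlue x) x := by
  have h := expNegInvGlue.hasDerivAt_polynomial_eval_inv_mul 1 x
  simp only [Polynomial.eval_one, one_mul, Polynomial.derivative_one, sub_zero, mul_one,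
    Polynomial.eval_pow, Polynomial.eval_X] at h
  exact h

/-- The derivative of `Real.smoothTransition = g/(g + g(1 - ·))`, `g = expNegInvGlue`, by the quotient
rule, with the numerator in the manifestly positive form `g'(x) g(1-x) + g(x) g'(1-x)`. [folklore] -/
private theorem hasDerivAt_smoothTransition (x : ℝ) :
    HasDerivAt Real.smoothTransition
      ((x⁻¹ ^ 2 * expNegInvGlue x * expNegInvGlue (1 - x) +
          expNegInvGlue x * ((1 - x)⁻¹ ^ 2 * expNegInvGlue (1 - x))) /
        (expNegInvGlue x + expNegInvGlue (1 - x)) ^ 2) x := by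
  have h1 := hasDerivAt_expNegInvGlue x
  have h2 : HasDerivAt (fun y => expNegInvGlue (1 - y))
      (-((1 - x)⁻¹ ^ 2 * expNegInvGlue (1 - x))) x := by
    have := HasDerivAt.comp x (hasDerivAt_expNegInvGlue (1 - x)) ((hasDerivAt_id x).const_sub 1)
    simpa [Function.comp_def] using this
  have hden := h1.add h2
  have hne : expNegInvGlue x + expNegInvGlue (1 - x) ≠ 0 := (smoothTransition.pos_denom x).ne'
  have key := h1.div hden hne
  refine HasDerivAt.congr_deriv (f := Real.smoothTransition) key ?_
  simp only [Pi.add_apply]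
  ring

/-- `Real.smoothTransition` has strictly positive derivative on `(0, 1)`. [folklore] -/
private theorem deriv_smoothTransition_pos {x : ℝ} (hx0 : 0 < x) (hx1 : x < 1) :
    0 < deriv Real.smoothTransition x := by
  rw [(hasDerivAt_smoothTransition x).deriv]
  have hg : 0 < expNegInvGlue x := expNegInvGlue.pos_of_pos hx0
  have hg' : 0 < expNegInvGlue (1 - x) := expNegInvGlue.pos_of_pos (by linarith)
  have hD := smoothTransition.pos_denom x
  have hx1' : 0 < 1 - x := by linarith
  positivity

/-- NON-VACUITY of the cutoff data of [II §2.4, p.10 L56–59]: for every `M > 1` (in [II],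
`M ≥ max{4³, 1/r₀}`) there is `a ∈ C^∞` with values in `[0,1]`, `a = 0` on `(-∞, M⁻⁴]`, `a = 1` on
`[M⁻², ∞)` and `a' > 0` on `(M⁻⁴, M⁻²)`, namely `a(x) = smoothTransition((x - M⁻⁴)/(M⁻² - M⁻⁴))`.
[cite: FeldmanSalmhoferTrubowitz1998, §2.4 (arXiv p.10 L56–59)] -/
theorem nonempty {M : ℝ} (hM : 1 < M) : Nonempty (ScaleCutoff M) := by
  set α : ℝ := (M ^ 4)⁻¹ with hα
  set β : ℝ := (M ^ 2)⁻¹ with hβ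
  have hM2 : 1 < M ^ 2 := by nlinarith
  have hαβ : α < β := by
    rw [hα, hβ]
    apply inv_strictAnti₀ (by positivity)
    nlinarith
  have hd : 0 < β - α := sub_pos.2 hαβ
  let t : ℝ → ℝ := fun x => (x - α) / (β - α)
  have ht : ∀ x, HasDerivAt t (β - α)⁻¹ x := fun x => by
    have := ((hasDerivAt_id x).sub_const α).div_const (β - α)
    simpa [t, div_eq_mul_inv] using this
  refine ⟨{ a := fun x => Real.smoothTransition (t x)
            contDiff := ?_, mem_Icc := ?_, eq_zero := ?_, eq_one := ?_, deriv_pos := ?_ }⟩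
  · exact Real.smoothTransition.contDiff.comp ((contDiff_id.sub contDiff_const).div_const _)
  · exact fun x => ⟨Real.smoothTransition.nonneg _, Real.smoothTransition.le_one _⟩
  · intro x hx
    exact Real.smoothTransition.zero_of_nonpos (div_nonpos_of_nonpos_of_nonneg (by linarith) hd.le)
  · intro x hx
    exact Real.smoothTransition.one_of_one_le ((one_le_div hd).2 (by linarith))
  · intro x hx1 hx2
    have ht0 : 0 < t x := div_pos (by linarith) hd
    have ht1 : t x < 1 := (div_lt_one hd).2 (by linarith)
    have hcomp : HasDerivAt (fun y => Real.smoothTransition (t y))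
        (((t x)⁻¹ ^ 2 * expNegInvGlue (t x) * expNegInvGlue (1 - t x) +
            expNegInvGlue (t x) * ((1 - t x)⁻¹ ^ 2 * expNegInvGlue (1 - t x))) /
          (expNegInvGlue (t x) + expNegInvGlue (1 - t x)) ^ 2 * (β - α)⁻¹) x :=
      (hasDerivAt_smoothTransition (t x)).comp x (ht x)
    rw [hcomp.deriv]
    refine mul_pos ?_ (inv_pos.2 hd)
    rw [← (hasDerivAt_smoothTransition (t x)).deriv]
    exact deriv_smoothTransition_pos ht0 ht1

/-- In particular the cutoff data exist for the scale parameters of [II] (`M ≥ max{4³, 1/r₀} ≥ 64`).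
[cite: FeldmanSalmhoferTrubowitz1998, §2.4 (arXiv p.10 L56)] -/
theorem nonempty_of_le {M r₀ : ℝ} (hM : max (4 ^ 3) r₀⁻¹ ≤ M) : Nonempty (ScaleCutoff M) :=
  nonempty (by linarith [le_max_left (4 ^ 3 : ℝ) r₀⁻¹, hM] : (1 : ℝ) < M)

end ScaleCutoff

end Literature.MathematicalPhysics.QuantumLattice.FermiRG

end
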